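import Mathlib.Data.Finset.Card
import Mathlib.Algebra.BigOperators.Group.Finset.Basic
import Mathlib.Algebra.Order.BigOperators.Group.Finset
import Mathlib.Data.Prod.Lex
import Mathlib.Tactic
import HarnessLib

/-!
# Cell calculus for honeycomb polygon surgery, I: bricks, contacts, perimeter, and the `+4` / `+2` insertion laws

Topic `Literature/Probability/RandomPlanarGeometry` (lane «pcv-sawmu», a-p4 g21; first module of the cell-set layer announced in
`HOME/pub-sawmu-a-p4/g21/omega/THEOREM-OMEGA-g21.md` §7 (the recursive `+2` injection «OMEGA» for `q_N(ℍ) ≤ q_{N+2}(ℍ)` is stated and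
proved there on CELL SETS; the tree's polygon surgery so far (`HexSAWPolygonStepTwoMain`, `…YStar`, `…StepTwoSixSlot` #630) is written on
boundary WALKS).

A hexagon of the brick-wall honeycomb lattice `ℍ` is recorded by its lower-left corner `c = (x, y) ∈ ℤ²` (bricks `[x, x+2] × [y, y+1]`,
`x + y` even — the parity is not needed for the counting lemmas of this file and is not imposed).  Its six neighbours are
`R c = (x+2, y)`, `L c = (x−2, y)`, `UR c = (x+1, y+1)`, `UL c = (x−1, y+1)`, `LR c = (x+1, y−1)`, `LL c = (x−1, y−1)`; two hexagons share a
lattice bond iff they are neighbours.  For a finite set `S` of hexagons the PERIMETER `perim S := Σ_{c ∈ S} #(nbrs c ∖ S)` counts the bonds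
of the hexagons of `S` not shared with another hexagon of `S`, i.e. the number of boundary bonds — for a polygon (a connected hole-free `S`)
this is the length `N` of its boundary loop (Jensen: honeycomb polygons by perimeter and area).  The file proves the bookkeeping behind every
`±` move of the lane's surgery:

* `perim_insert` — inserting a hexagon `c ∉ S` with `m = #(nbrs c ∩ S)` contacts changes the perimeter by `6 − 2m`
  (stated additively: `perim (insert c S) + 2·m = perim S + 6`); corollaries `perim_insert_of_contacts_eq_one` (`+4`, a new leaf) and
  `perim_insert_of_contacts_eq_two` (`+2`);
* `IsLexmax S t` — `t` is the hexagon of `S` that is maximal for (row, then abscissa) — the hexagon under the «top corner» of the tree's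
  walk files — with `ur_notMem`, `ul_notMem`, `r_notMem`, `notMem_of_row_lt` (nothing of `S` lies above the top row or right of `t` on it);
* `perim_insert_ul_of_isLexmax` — the CLASS-X FLIP of Madras–Slade's unit-square surgery transplanted to `ℍ`
  (`HexSAWPolygonStepTwoMain.spliceX` in walk form): if `L t ∈ S` then inserting `UL t` is a `+2` move, its contacts being exactly `L t` and `t`;
* `perim_insert_ur_of_isLexmax` — growing an up-right LEAF on the top hexagon is a `+4` move (contacts exactly `{t}`).

Not in this file (sequels): connectedness / hole-freeness of cell sets and the bijection «canonical rooted boundary walks `canonEnd n` ↔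
hole-free connected cell sets of perimeter `n+1` up to translation», which turns these counting laws into statements about `hexPolygonNumber`.

Sources: N. Madras, G. Slade, *The Self-Avoiding Walk* (1993), §3.2, proof of Theorem 3.2.3 (the unit-square surgery at the lexicographically
largest vertex, `ℤ^d`) [MadrasSlade1993]; I. Jensen, J. Phys.: Conf. Ser. 42 (2006) 163–178 (honeycomb polygons counted by perimeter; cells =
hexagons) [Jensen2006HoneycombPolygons]; S. G. Whittington, LNP 775 (2009) §2 (polygons and their perimeter/area statistics)
[Whittington2009LatticePolygons].  Label (lane): LANE INFRASTRUCTURE for an open combinatorial item; NEW IN WRITING: nothing beyond bookkeeping.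
-/

open Finset

namespace Literature.Probability.RandomPlanarGeometry.SAW

namespace HexCell

/-- A hexagon of the brick-wall lattice, recorded by the lower-left corner of its brick. [cite: Jensen2006HoneycombPolygons, §2 (polygons on the honeycomb lattice as collections of hexagons)] -/
abbrev Cell : Type := ℤ × ℤ

/-- Right neighbour `(x+2, y)`. [cite: Jensen2006HoneycombPolygons, §2] -/
def R (c : Cell) : Cell := (c.1 + 2, c.2)
/-- Left neighbour `(x−2, y)`. [cite: Jensen2006HoneycombPolygons, §2] -/
def L (c : Cell) : Cell := (c.1 - 2, c.2)
/-- Upper-right neighbour `(x+1, y+1)`. [cite: Jensen2006HoneycombPolygons, §2] -/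
def UR (c : Cell) : Cell := (c.1 + 1, c.2 + 1)
/-- Upper-left neighbour `(x−1, y+1)`. [cite: Jensen2006HoneycombPolygons, §2] -/
def UL (c : Cell) : Cell := (c.1 - 1, c.2 + 1)
/-- Lower-right neighbour `(x+1, y−1)`. [cite: Jensen2006HoneycombPolygons, §2] -/
def LR (c : Cell) : Cell := (c.1 + 1, c.2 - 1)
/-- Lower-left neighbour `(x−1, y−1)`. [cite: Jensen2006HoneycombPolygons, §2] -/
def LL (c : Cell) : Cell := (c.1 - 1, c.2 - 1)

/-- The abscissa of `R c`. [cite: Jensen2006HoneycombPolygons, §2 (hexagon cells)] -/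
@[simp] theorem R_fst (c : Cell) : (R c).1 = c.1 + 2 := rfl
/-- The row of `R c`. [cite: Jensen2006HoneycombPolygons, §2 (hexagon cells)] -/
@[simp] theorem R_snd (c : Cell) : (R c).2 = c.2 := rfl
/-- The abscissa of `L c`. [cite: Jensen2006HoneycombPolygons, §2 (hexagon cells)] -/
@[simp] theorem L_fst (c : Cell) : (L c).1 = c.1 - 2 := rfl
/-- The row of `L c`. [cite: Jensen2006HoneycombPolygons, §2 (hexagon cells)] -/
@[simp] theorem L_snd (c : Cell) : (L c).2 = c.2 := rfl
/-- The abscissa of `UR c`. [cite: Jensen2006HoneycombPolygons, §2 (hexagon cells)] -/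
@[simp] theorem UR_fst (c : Cell) : (UR c).1 = c.1 + 1 := rfl
/-- The row of `UR c`. [cite: Jensen2006HoneycombPolygons, §2 (hexagon cells)] -/
@[simp] theorem UR_snd (c : Cell) : (UR c).2 = c.2 + 1 := rfl
/-- The abscissa of `UL c`. [cite: Jensen2006HoneycombPolygons, §2 (hexagon cells)] -/
@[simp] theorem UL_fst (c : Cell) : (UL c).1 = c.1 - 1 := rfl
/-- The row of `UL c`. [cite: Jensen2006HoneycombPolygons, §2 (hexagon cells)] -/
@[simp] theorem UL_snd (c : Cell) : (UL c).2 = c.2 + 1 := rfl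
/-- The abscissa of `LR c`. [cite: Jensen2006HoneycombPolygons, §2 (hexagon cells)] -/
@[simp] theorem LR_fst (c : Cell) : (LR c).1 = c.1 + 1 := rfl
/-- The row of `LR c`. [cite: Jensen2006HoneycombPolygons, §2 (hexagon cells)] -/
@[simp] theorem LR_snd (c : Cell) : (LR c).2 = c.2 - 1 := rfl
/-- The abscissa of `LL c`. [cite: Jensen2006HoneycombPolygons, §2 (hexagon cells)] -/
@[simp] theorem LL_fst (c : Cell) : (LL c).1 = c.1 - 1 := rfl
/-- The row of `LL c`. [cite: Jensen2006HoneycombPolygons, §2 (hexagon cells)] -/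
@[simp] theorem LL_snd (c : Cell) : (LL c).2 = c.2 - 1 := rfl

/-- The six neighbours of a hexagon, in the cyclic order `LL, LR, R, UR, UL, L`. [cite: Jensen2006HoneycombPolygons, §2] -/
def nbrs (c : Cell) : Finset Cell := {LL c, LR c, R c, UR c, UL c, L c}

/-- Membership in `nbrs c` in coordinates. [cite: Jensen2006HoneycombPolygons, §2] -/
theorem mem_nbrs_iff {c d : Cell} : d ∈ nbrs c ↔
    d = (c.1 - 1, c.2 - 1) ∨ d = (c.1 + 1, c.2 - 1) ∨ d = (c.1 + 2, c.2) ∨ d = (c.1 + 1, c.2 + 1) ∨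
      d = (c.1 - 1, c.2 + 1) ∨ d = (c.1 - 2, c.2) := by
  simp [nbrs, LL, LR, R, UR, UL, L]

/-- The neighbour relation is symmetric. [cite: Jensen2006HoneycombPolygons, §2] -/
theorem mem_nbrs_comm {c d : Cell} : d ∈ nbrs c ↔ c ∈ nbrs d := by
  obtain ⟨a, b⟩ := c
  obtain ⟨p, q⟩ := d
  simp only [mem_nbrs_iff, Prod.mk.injEq]
  omega

/-- A hexagon is not its own neighbour. [cite: Jensen2006HoneycombPolygons, §2] -/
theorem self_notMem_nbrs (c : Cell) : c ∉ nbrs c := by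
  obtain ⟨a, b⟩ := c
  simp only [mem_nbrs_iff, Prod.mk.injEq]
  omega

/-- Every hexagon has exactly six neighbours. [cite: Jensen2006HoneycombPolygons, §2] -/
theorem card_nbrs (c : Cell) : #(nbrs c) = 6 := by
  obtain ⟨a, b⟩ := c
  simp only [nbrs, LL, LR, R, UR, UL, L]
  rw [card_insert_of_notMem, card_insert_of_notMem, card_insert_of_notMem, card_insert_of_notMem, card_insert_of_notMem,
    card_singleton] <;> simp <;> omega

/-- **Perimeter** of a finite set of hexagons: the number of bonds of its hexagons not shared with another hexagon of the set (for a
polygon, the length of its boundary loop). [cite: Jensen2006HoneycombPolygons, §2 (polygons enumerated by perimeter)] -/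
def perim (S : Finset Cell) : ℕ := ∑ c ∈ S, #(nbrs c \ S)

/-- The empty set has perimeter `0`. [cite: Jensen2006HoneycombPolygons, §2] -/
@[simp] theorem perim_empty : perim ∅ = 0 := by simp [perim]

/-- A single hexagon has perimeter `6`. [cite: Jensen2006HoneycombPolygons, §2] -/
theorem perim_singleton (c : Cell) : perim {c} = 6 := by
  simp only [perim, sum_singleton]
  rw [sdiff_singleton_eq_erase, erase_eq_of_notMem (self_notMem_nbrs c), card_nbrs]

/-- The contacts of a hexagon `c` in `S`, counted from `S`: the hexagons of `S` having `c` as a neighbour are exactly the neighbours of `c`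
lying in `S`. [cite: Jensen2006HoneycombPolygons, §2] -/
theorem card_filter_mem_nbrs (S : Finset Cell) (c : Cell) : #(S.filter fun d => c ∈ nbrs d) = #(nbrs c ∩ S) := by
  congr 1
  ext d
  simp only [mem_filter, mem_inter]
  constructor
  · rintro ⟨hd, h⟩; exact ⟨mem_nbrs_comm.2 h, hd⟩
  · rintro ⟨h, hd⟩; exact ⟨hd, mem_nbrs_comm.1 h⟩

/-- **The insertion law**: inserting a hexagon `c ∉ S` with `m = #(nbrs c ∩ S)` contacts changes the perimeter by `6 − 2m`
(each contact hides one bond of `c` and one bond of the neighbour).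
[cite: MadrasSlade1993, §3.2 (proof of Theorem 3.2.3: the effect of the unit-square surgery on the length)] -/
theorem perim_insert {S : Finset Cell} {c : Cell} (hc : c ∉ S) :
    perim (insert c S) + 2 * #(nbrs c ∩ S) = perim S + 6 := by
  classical
  unfold perim
  rw [sum_insert hc]
  -- the new hexagon contributes `#(nbrs c \ S)` (it is not its own neighbour)
  have h0 : nbrs c \ insert c S = nbrs c \ S := by
    ext d
    simp only [mem_sdiff, mem_insert, not_or]
    constructor
    · rintro ⟨h1, -, h3⟩; exact ⟨h1, h3⟩
    · rintro ⟨h1, h3⟩; exact ⟨h1, fun h => self_notMem_nbrs c (h ▸ h1), h3⟩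
  rw [h0]
  -- each old hexagon loses the bond towards `c` if `c` is one of its neighbours
  have h1 : ∀ d ∈ S, #(nbrs d \ S) = #(nbrs d \ insert c S) + if c ∈ nbrs d then 1 else 0 := by
    intro d hd
    split_ifs with h
    · have : nbrs d \ S = insert c (nbrs d \ insert c S) := by
        ext e
        simp only [mem_sdiff, mem_insert, not_or]
        constructor
        · rintro ⟨h1, h2⟩
          by_cases hec : e = c
          · exact Or.inl hec
          · exact Or.inr ⟨h1, hec, h2⟩
        · rintro (rfl | ⟨h1, -, h2⟩)
          · exact ⟨h, hc⟩
          · exact ⟨h1, h2⟩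
      rw [this, card_insert_of_notMem]
      simp
    · simp only [add_zero]
      congr 1
      ext e
      simp only [mem_sdiff, mem_insert, not_or]
      constructor
      · rintro ⟨h1, h2⟩; exact ⟨h1, fun hec => h (hec ▸ h1), h2⟩
      · rintro ⟨h1, -, h2⟩; exact ⟨h1, h2⟩
  have h2 : ∑ d ∈ S, #(nbrs d \ S) = ∑ d ∈ S, #(nbrs d \ insert c S) + #(nbrs c ∩ S) := by
    rw [sum_congr rfl h1, sum_add_distrib, ← card_filter_mem_nbrs S c, card_eq_sum_ones, sum_filter]
  have h3 : #(nbrs c \ S) + #(nbrs c ∩ S) = 6 := by rw [card_sdiff_add_card_inter, card_nbrs]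
  omega

/-- A new LEAF (`c ∉ S` with exactly one contact) raises the perimeter by `4`. [cite: MadrasSlade1993, §3.2 (proof of Theorem 3.2.3)] -/
theorem perim_insert_of_contacts_eq_one {S : Finset Cell} {c : Cell} (hc : c ∉ S) (h : #(nbrs c ∩ S) = 1) :
    perim (insert c S) = perim S + 4 := by
  have := perim_insert hc; rw [h] at this; omega

/-- A hexagon with exactly two contacts raises the perimeter by `2` when inserted — the basic `+2` move.
[cite: MadrasSlade1993, §3.2 (proof of Theorem 3.2.3: `N ↦ N + 2`)] -/
theorem perim_insert_of_contacts_eq_two {S : Finset Cell} {c : Cell} (hc : c ∉ S) (h : #(nbrs c ∩ S) = 2) :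
    perim (insert c S) = perim S + 2 := by
  have := perim_insert hc; rw [h] at this; omega

/-! ### The top hexagon -/

/-- `t` is the **top hexagon** of `S`: it lies in `S` and is maximal for (row, then abscissa) — the hexagon carrying the lexicographically
largest vertex of the boundary in the tree's walk files. [cite: MadrasSlade1993, §3.2 (proof of Theorem 3.2.3: the lexicographically largest point)] -/
def IsLexmax (S : Finset Cell) (t : Cell) : Prop :=
  t ∈ S ∧ ∀ c ∈ S, c.2 < t.2 ∨ (c.2 = t.2 ∧ c.1 ≤ t.1)

/-- Every nonempty finite set of hexagons has a top hexagon. [cite: MadrasSlade1993, §3.2 (proof of Theorem 3.2.3)] -/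
theorem exists_isLexmax {S : Finset Cell} (hS : S.Nonempty) : ∃ t, IsLexmax S t := by
  obtain ⟨t, ht, hmax⟩ := exists_max_image S (fun c : Cell => toLex (c.2, c.1)) hS
  refine ⟨t, ht, fun c hc => ?_⟩
  have h := hmax c hc
  rw [Prod.Lex.toLex_le_toLex] at h
  rcases h with h | ⟨h1, h2⟩
  · exact Or.inl h
  · exact Or.inr ⟨h1, h2⟩

/-- The top hexagon is unique. [cite: MadrasSlade1993, §3.2 (proof of Theorem 3.2.3)] -/
theorem IsLexmax.unique {S : Finset Cell} {t t' : Cell} (h : IsLexmax S t) (h' : IsLexmax S t') : t = t' := by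
  obtain ⟨a, b⟩ := t
  obtain ⟨a', b'⟩ := t'
  have h1 := h.2 _ h'.1
  have h2 := h'.2 _ h.1
  simp only [Prod.mk.injEq] at h1 h2 ⊢
  omega

/-- Nothing of `S` lies on a row above the top hexagon. [cite: MadrasSlade1993, §3.2 (proof of Theorem 3.2.3)] -/
theorem IsLexmax.notMem_of_row_lt {S : Finset Cell} {t c : Cell} (h : IsLexmax S t) (hc : t.2 < c.2) : c ∉ S := by
  intro hcS
  rcases h.2 c hcS with h1 | ⟨h1, -⟩ <;> omega

/-- Nothing of `S` lies right of the top hexagon on its row. [cite: MadrasSlade1993, §3.2 (proof of Theorem 3.2.3)] -/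
theorem IsLexmax.notMem_of_right {S : Finset Cell} {t c : Cell} (h : IsLexmax S t) (hr : c.2 = t.2) (hx : t.1 < c.1) : c ∉ S := by
  intro hcS
  rcases h.2 c hcS with h1 | ⟨-, h2⟩ <;> omega

/-- `UR t ∉ S` for the top hexagon. [cite: MadrasSlade1993, §3.2 (proof of Theorem 3.2.3)] -/
theorem IsLexmax.ur_notMem {S : Finset Cell} {t : Cell} (h : IsLexmax S t) : UR t ∉ S :=
  h.notMem_of_row_lt (by simp)

/-- `UL t ∉ S` for the top hexagon. [cite: MadrasSlade1993, §3.2 (proof of Theorem 3.2.3)] -/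
theorem IsLexmax.ul_notMem {S : Finset Cell} {t : Cell} (h : IsLexmax S t) : UL t ∉ S :=
  h.notMem_of_row_lt (by simp)

/-- `R t ∉ S` for the top hexagon. [cite: MadrasSlade1993, §3.2 (proof of Theorem 3.2.3)] -/
theorem IsLexmax.r_notMem {S : Finset Cell} {t : Cell} (h : IsLexmax S t) : R t ∉ S :=
  h.notMem_of_right (by simp) (by simp)

/-- **The class-X flip is a `+2` move on cell sets**: if the top hexagon `t` has its left neighbour in `S`, the hexagon `UL t` (above the
bond between `L t` and `t`) has exactly the two contacts `L t`, `t`, so inserting it raises the perimeter by `2`.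
This is `HexSAWPolygonStepTwoMain.spliceX` read on hexagons. [cite: MadrasSlade1993, §3.2, Theorem 3.2.3 (3.2.3) and its proof (surgery at the largest point)] -/
theorem perim_insert_ul_of_isLexmax {S : Finset Cell} {t : Cell} (h : IsLexmax S t) (hL : L t ∈ S) :
    perim (insert (UL t) S) = perim S + 2 := by
  apply perim_insert_of_contacts_eq_two h.ul_notMem
  obtain ⟨a, b⟩ := t
  have ht := h.1
  -- the contacts of `UL t = (a−1, b+1)` are `LL = (a−2, b) = L t` and `LR = (a, b) = t`; the other four neighbours lie on rows `> b`
  -- or right of `t`… : `R (UL t) = (a+1, b+1)`, `UR = (a, b+2)`, `UL = (a−2, b+2)`, `L = (a−3, b+1)`.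
  have e : nbrs (UL (a, b)) ∩ S = {(a - 2, b), (a, b)} := by
    ext d
    simp only [mem_inter, mem_nbrs_iff, UL_fst, UL_snd, mem_insert, mem_singleton]
    constructor
    · rintro ⟨hd, hdS⟩
      rcases hd with rfl | rfl | rfl | rfl | rfl | rfl
      · left; ext <;> simp; ring
      · right; ext <;> simp
      · exact absurd hdS (h.notMem_of_row_lt (by simp))
      · exact absurd hdS (h.notMem_of_row_lt (by simp))
      · exact absurd hdS (h.notMem_of_row_lt (by simp))
      · exact absurd hdS (h.notMem_of_row_lt (by simp))
    · rintro (rfl | rfl)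
      · refine ⟨Or.inl ?_, ?_⟩
        · ext <;> simp; ring
        · simpa [L] using hL
      · refine ⟨Or.inr (Or.inl ?_), ht⟩
        ext <;> simp
  rw [e, card_insert_of_notMem, card_singleton]
  simp only [mem_singleton, Prod.mk.injEq, not_and]
  intro h'; omega

/-- **Growing an up-right leaf on the top hexagon is a `+4` move**: `UR t` has the single contact `t`.
[cite: MadrasSlade1993, §3.2 (proof of Theorem 3.2.3: attaching a unit square)] -/
theorem perim_insert_ur_of_isLexmax {S : Finset Cell} {t : Cell} (h : IsLexmax S t) :
    perim (insert (UR t) S) = perim S + 4 := by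
  apply perim_insert_of_contacts_eq_one h.ur_notMem
  obtain ⟨a, b⟩ := t
  have ht := h.1
  -- neighbours of `UR t = (a+1, b+1)`: `LL = (a, b) = t`, `LR = (a+2, b) = R t ∉`, `R = (a+3, b+1)`, `UR = (a+2, b+2)`, `UL = (a, b+2)`,
  -- `L = (a−1, b+1) = UL t` — the last four lie above the top row.
  have e : nbrs (UR (a, b)) ∩ S = {(a, b)} := by
    ext d
    simp only [mem_inter, mem_nbrs_iff, UR_fst, UR_snd, mem_singleton]
    constructor
    · rintro ⟨hd, hdS⟩
      rcases hd with rfl | rfl | rfl | rfl | rfl | rfl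
      · ext <;> simp
      · exact absurd hdS (h.notMem_of_right (by simp) (by simp))
      · exact absurd hdS (h.notMem_of_row_lt (by simp))
      · exact absurd hdS (h.notMem_of_row_lt (by simp))
      · exact absurd hdS (h.notMem_of_row_lt (by simp))
      · exact absurd hdS (h.notMem_of_row_lt (by simp))
    · rintro rfl
      exact ⟨Or.inl (by ext <;> simp), ht⟩
  rw [e, card_singleton]

end HexCell

end Literature.Probability.RandomPlanarGeometry.SAW
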